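import Summits.QuantumFields.YangMills.Theorems.BalabanUVNodesN21ChargeByCounting
import Summits.QuantumFields.YangMills.Theorems.BalabanUVNodesN21BranchQuotientBrackets

/-!
# N21 (NE7c) — module 38h «THE COLLAR CHARGE BY COUNTING» (LENS nearmiss v24.0 ROW C ∕ Card 71 (k2), the 38f∕38g pen's half of the roads' junction):
# a bounded odds factor `(1+Q₀)` per COLLAR BLOCK of a sent component is charged against the per-cube currency `q_□ = e^{−p₀}` by counting alone —
# 38f's charge survives with `q̄′ := q_□·(1+Q₀)^c` (`c` collar blocks per cube), i.e. iff `c·log(1+Q₀) ≤ p₀`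

Seat `pub-ymgap-dag-n21-e` (g13), own hand; lane `--kind proof --supports stmt-QuantumFields-20544 --as helper` (K3⁷ `SpineGivenEndpointR13SepCoPH`).
Count-neutral.

THE LENS'S ASK (v24.0 Card 71 ∕ ROW C «n21-d (G15∕G16 author) AND dag-n21-e g13 (38g pen) — the roads' junction», abridged).  After the dilation road
(n21-d G16, lens Card 69) the honest residual is the Γ-COLLAR: a block read by a LARGE-field letter `{u'' ≥ θ''}` of a sent component, where inward
dilation exits the cut and the exits are charged to a conditional odds `Q''` under the block's cut law at relative width `O(1∕d)` — «BOUNDED suffices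
(`Q'' ≤ Q₀`), not small; then 38f's counting charges `log(1+Q₀)` per collar block against `p₀`»; kill-test (k2): «if the count of collar blocks per sent
component times `log(1+Q₀)` is not dominated by the component's `p₀` — bookkeeping on 38f's counting (n21-e's `charge_le_of_liveWindow`)».

WHAT IS PROVED ([textbook] real arithmetic + 38f BY NAME).  `collar_component_bound`: a single-component bound of the COLLAR shape — one factor
`q_□ ∈ [0, 1]`-scale per cube of the component and one factor `(1+Q₀) ≥ 1` per collar block, `q_□^k·(1+Q₀)^m` with `k ≥ 1` cubes and `m ≤ c·k` collar
blocks — is at most the ONE-CUBE currency `q̄′ := q_□·(1+Q₀)^c` as soon as `q̄′ ≤ 1`; `charge_le_of_parts_collar` ∕ `charge_le_of_liveWindow_collar`: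
hence 38f's `charge_le_of_parts` ∕ `charge_le_of_liveWindow` hold VERBATIM with `q̄ := q̄′` — 38c's `hcharge` with `δr := (1 + q_□(1+Q₀)^c)^n − 1`,
K-uniform by `LiveWindow.count`; `collar_currency_eq_exp` ∕ `collar_currency_le_one_iff`: with `q_□ = e^{−p₀}` the currency is
`e^{−(p₀ − c·log(1+Q₀))}` and `q̄′ ≤ 1 ↔ c·log(1+Q₀) ≤ p₀` — (k2) as a kernel sentence: the collar costs `log(1+Q₀)` PER COLLAR BLOCK against `p₀`,
nothing else.  §2 a numeric sanity instance (`collar_currency_sanity`: `c = 80`, `Q₀ = 1`, `p₀ = 60` passes since `80·log 2 < 56`).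
v1.1 (§3, APPEND-ONLY; +1 import 38g): THE BRACKETS' CONSTANT IS A PER-CUBE CURRENCY (lens KT-66 (i) as a kernel sentence) — with gap `≥ g`, allowance
`≤ e`, background term `≤ b` and fibre-volume log `≤ v` PER CUBE over `k` cubes, 38g's `e^{η+β−G}·(vS∕vW) ≤ q_□^k`, `q_□ := e^{−(g−e−b−v)}`
(`brackets_exponent_le`, `bracketsConst_le_perCube`), hence 38c's `hquotA` on the refined pair with `q = q_□^k` (`hquot_perCube_of_actionBrackets` =
38g `hquot_of_actionBrackets_cmp` ∘ §3) — exactly the currency §1 and 38f consume as `qc ≤ q_□^{#part}·(1+Q₀)^m`.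

DISPLAYED, NEVER ESTIMATED (other lanes' numbers): `Q₀` = the collar block's conditional odds bound (lens Card 71 `Q''`; n21-d's G15 instrument
`measure_shell_iSup_le_preShellCount_defect` at width `δ = τ(θ''+c₀)`, ROW C's first half); `c` = collar blocks per cube of a component (geometry of the
(1.88) exterior layer, [IV] p. 197; t23 pen); `p₀ = p₀(g_k)` = the per-cube large-field gain ([V] p. 381, `B15Chi175` header; 38g's located statement (1));
`n ≥ ν̄` (`LiveWindow.count`).  Whether ROW C's «bounded suffices» survives is EXACTLY `c·log(1+Q₀) ≤ p₀` — recorded, not asserted.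

HONEST FRAMING.  [textbook] real arithmetic + [folklore] bookkeeping; 0 def, 0 sorry; NOTHING of Bałaban's is asserted; NE7c ((M1) at the live slots) is
NOT PRINTED and NOT PROVED; N21 NOT discharged; count-neutral; one finite 𝕋⁴ at fixed ε — nothing about ℝ⁴ ∕ OS ∕ mass gap ∕ Clay.

CITATION HEADER (lean-in-tree rule).  BY NAME: 38g `N21BranchQuotientBrackets.hquot_of_actionBrackets_cmp` (§3); 38f `N21ChargeByCounting.charge_le_of_parts` ∕ `charge_le_of_liveWindow` (⟸ 38c `charge_le_of_components`
⟸ 38a §C `senderCharge_le_pow`, lens Card 57); `T4ShellMeasureLevels.LiveWindow`; Mathlib `pow_le_pow_right₀`, `pow_le_pow_of_le_one`, `Real.exp_log`,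
`Real.exp_nat_mul`, `Real.exp_le_one_iff`, `Real.log_two_lt_d9` (§2 numerics).  Context: 38g `N21BranchQuotientBrackets` (the per-cube quotient's brackets),
n21-d G15 `…N21LeftHazardDefect.measure_shell_iSup_le_preShellCount_defect` ∕ G16 `…N21DilationHazard` (the instruments ROW C names for `Q₀`).
-/

set_option autoImplicit false

open scoped BigOperators ENNReal

namespace Summit.QuantumFields.YangMills.Theorems.N21CollarChargeByCounting

open Summit.QuantumFields.YangMills.Theorems.N21ChargeByCounting (charge_le_of_parts charge_le_of_liveWindow)
open Literature.MathematicalPhysics.QuantumFieldTheory.Balaban1983to89.T4ShellMeasureLevels (LiveWindow)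

/-! ## §1 the collar factor is charged against the per-cube currency by counting -/

/-- **ONE COMPONENT**: `k ≥ 1` cubes at `q_□ ≥ 0` each and `m ≤ c·k` collar blocks at `(1+Q₀) ≥ 1` each give at most the ONE-CUBE currency
`q̄′ = q_□·(1+Q₀)^c`, provided `q̄′ ≤ 1` (the surplus cubes only help). [textbook] -/
theorem collar_component_bound {qsq Q₀ : ℝ} {c k m : ℕ} (hq0 : 0 ≤ qsq) (hQ : 0 ≤ Q₀) (hk : 1 ≤ k) (hm : m ≤ c * k)
    (hsmall : qsq * (1 + Q₀) ^ c ≤ 1) :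
    qsq ^ k * (1 + Q₀) ^ m ≤ qsq * (1 + Q₀) ^ c := by
  have h1 : (1 : ℝ) ≤ 1 + Q₀ := by linarith
  calc qsq ^ k * (1 + Q₀) ^ m ≤ qsq ^ k * (1 + Q₀) ^ (c * k) :=
        mul_le_mul_of_nonneg_left (pow_le_pow_right₀ h1 hm) (pow_nonneg hq0 _)
    _ = (qsq * (1 + Q₀) ^ c) ^ k := by rw [mul_pow, ← pow_mul]
    _ ≤ (qsq * (1 + Q₀) ^ c) ^ 1 := pow_le_pow_of_le_one (by positivity) hsmall hk
    _ = qsq * (1 + Q₀) ^ c := pow_one _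

variable {α Cp ι : Type*} [DecidableEq α] [DecidableEq Cp]

/-- **THE COLLAR CHARGE FROM DISJOINT COMPONENTS INSIDE A CUBE SET** — 38f `charge_le_of_parts` with single-component bounds of the COLLAR shape:
ON senders labelled injectively by non-empty sub-families of a family `U` of pairwise disjoint non-empty unions of cubes from `S`, `q s ≤ Π_{i ∈ comp s} qc i`,
`0 ≤ qc i ≤ q_□^{#part i}·(1+Q₀)^{m i}` with `m i ≤ c·#part i` collar blocks, and `q_□(1+Q₀)^c ≤ 1`, have charge `≤ (1 + q_□(1+Q₀)^c)^n − 1` for any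
`n ≥ #S`. [textbook] -/
theorem charge_le_of_parts_collar (A : Finset ι) (U : Finset Cp) (part : Cp → Finset α) (S : Finset α) (comp : ι → Finset Cp)
    (hsub : ∀ i ∈ U, part i ⊆ S) (hne : ∀ i ∈ U, (part i).Nonempty) (hdisj : (U : Set Cp).PairwiseDisjoint part)
    (hinj : Set.InjOn comp A) (hcomp : ∀ s ∈ A, comp s ∈ U.powerset.erase ∅)
    {qr : ι → ℝ} {qc : Cp → ℝ} {m : Cp → ℕ} {qsq Q₀ : ℝ} {c n : ℕ} (hqr0 : ∀ s ∈ A, 0 ≤ qr s)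
    (hqr : ∀ s ∈ A, qr s ≤ ∏ i ∈ comp s, qc i) (hqc0 : ∀ i ∈ U, 0 ≤ qc i)
    (hqc : ∀ i ∈ U, qc i ≤ qsq ^ (part i).card * (1 + Q₀) ^ m i) (hm : ∀ i ∈ U, m i ≤ c * (part i).card)
    (hq0 : 0 ≤ qsq) (hQ : 0 ≤ Q₀) (hsmall : qsq * (1 + Q₀) ^ c ≤ 1) (hn : S.card ≤ n) :
    ∑ s ∈ A, ENNReal.ofReal (qr s) ≤ ENNReal.ofReal ((1 + qsq * (1 + Q₀) ^ c) ^ n - 1) :=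
  charge_le_of_parts A U part S comp hsub hne hdisj hinj hcomp hqr0 hqr hqc0
    (fun i hi => (hqc i hi).trans (collar_component_bound hq0 hQ (Finset.card_pos.2 (hne i hi)) (hm i hi) hsmall))
    (by positivity) hn

/-- **… AT A LIVE LEVEL OF THE WINDOW** — 38f `charge_le_of_liveWindow` with collar-shaped single-component bounds: 38c's charge binder holds with
`δr := (1 + q_□(1+Q₀)^c)^n − 1`, `n ≥ ν̄`, K-UNIFORM BY COUNTING; the inputs are the per-cube quotient `q_□` (NODE O; 38g's two brackets), the
collar odds bound `Q₀` (n21-d's hazard instrument, lens ROW C) and the collar geometry `c` (t23 pen). [textbook] -/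
theorem charge_le_of_liveWindow_collar {σ : Type*} {C : ℕ → Finset σ} {lvl : ℕ → σ → ℕ} {N₁ : ℕ} {νbar : ℝ}
    (hwin : LiveWindow C lvl N₁ νbar) {n : ℕ} (hn : νbar ≤ n) (K j : ℕ) (A : Finset ι) (U : Finset Cp) (part : Cp → Finset σ)
    (comp : ι → Finset Cp) (hsub : ∀ i ∈ U, part i ⊆ (C K).filter (fun s => lvl K s = j)) (hne : ∀ i ∈ U, (part i).Nonempty)
    (hdisj : (U : Set Cp).PairwiseDisjoint part) (hinj : Set.InjOn comp A) (hcomp : ∀ s ∈ A, comp s ∈ U.powerset.erase ∅)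
    {qr : ι → ℝ} {qc : Cp → ℝ} {m : Cp → ℕ} {qsq Q₀ : ℝ} {c : ℕ} (hqr0 : ∀ s ∈ A, 0 ≤ qr s)
    (hqr : ∀ s ∈ A, qr s ≤ ∏ i ∈ comp s, qc i) (hqc0 : ∀ i ∈ U, 0 ≤ qc i)
    (hqc : ∀ i ∈ U, qc i ≤ qsq ^ (part i).card * (1 + Q₀) ^ m i) (hm : ∀ i ∈ U, m i ≤ c * (part i).card)
    (hq0 : 0 ≤ qsq) (hQ : 0 ≤ Q₀) (hsmall : qsq * (1 + Q₀) ^ c ≤ 1) :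
    ∑ s ∈ A, ENNReal.ofReal (qr s) ≤ ENNReal.ofReal ((1 + qsq * (1 + Q₀) ^ c) ^ n - 1) := by
  classical
  exact charge_le_of_liveWindow hwin hn K j A U part comp hsub hne hdisj hinj hcomp hqr0 hqr hqc0
    (fun i hi => (hqc i hi).trans (collar_component_bound hq0 hQ (Finset.card_pos.2 (hne i hi)) (hm i hi) hsmall))
    (by positivity)

/-! ## §2 the currency in print's exponent: `log(1+Q₀)` per collar block against `p₀` (lens (k2) as a kernel sentence) -/

/-- with `q_□ = e^{−p₀}` the collar currency is `e^{−(p₀ − c·log(1+Q₀))}`. [textbook] -/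
theorem collar_currency_eq_exp (p₀ Q₀ : ℝ) (c : ℕ) (hQ : 0 ≤ Q₀) :
    Real.exp (-p₀) * (1 + Q₀) ^ c = Real.exp (-(p₀ - c * Real.log (1 + Q₀))) := by
  have hpos : 0 < 1 + Q₀ := by linarith
  conv_lhs => rw [← Real.exp_log hpos, ← Real.exp_nat_mul, ← Real.exp_add]
  congr 1
  ring

/-- **(k2) AS A KERNEL SENTENCE**: the collar currency is a currency (`≤ 1`) iff the collar blocks per cube times `log(1+Q₀)` are dominated by
`p₀`. [textbook] -/
theorem collar_currency_le_one_iff (p₀ Q₀ : ℝ) (c : ℕ) (hQ : 0 ≤ Q₀) :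
    Real.exp (-p₀) * (1 + Q₀) ^ c ≤ 1 ↔ c * Real.log (1 + Q₀) ≤ p₀ := by
  rw [collar_currency_eq_exp p₀ Q₀ c hQ, Real.exp_le_one_iff]
  constructor <;> intro h <;> linarith

/-- numeric sanity (NOT the record's numbers): `c = 80` collar blocks per cube at odds bound `Q₀ = 1` cost `80·log 2 < 56`, so any per-cube gain
`p₀ ≥ 56` keeps the collar currency a currency. [textbook] -/
theorem collar_currency_sanity {p₀ : ℝ} (hp : 56 ≤ p₀) : Real.exp (-p₀) * (1 + (1 : ℝ)) ^ (80 : ℕ) ≤ 1 := by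
  rw [collar_currency_le_one_iff p₀ 1 80 zero_le_one, one_add_one_eq_two]
  have h2 := Real.log_two_lt_d9
  norm_num at h2 ⊢
  linarith

/-! ## §3 (v1.1) THE BRACKETS' CONSTANT IS A PER-CUBE CURRENCY (lens KT-66 (i) as a kernel sentence): 38g's `e^{η+β−G}·(vS∕vW)` is `≤ q_□^k`
over `k` cubes as soon as gap, allowance, background term and fibre-volume log are EXTENSIVE — the currency 38f∕38h consume as `qc ≤ q_□^{#part}` -/

section PerCube

open MeasureTheory Set Function
open Literature.MathematicalPhysics.QuantumFieldTheory.Balaban1983to89.B15.BasicStep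
open Summit.QuantumFields.YangMills.Theorems.N21BranchQuotientBrackets (hquot_of_actionBrackets_cmp)

/-- EXTENSIVE exponent bookkeeping: a gap of at least `g` per cube, an allowance of at most `e` per cube and a background term of at most `b` per
cube over `k` cubes give the brackets' exponent `η + β − G ≤ −(g − e − b)·k`. [textbook] -/
theorem brackets_exponent_le {G η β g e b : ℝ} {k : ℕ} (hG : g * k ≤ G) (hη : η ≤ e * k) (hβ : β ≤ b * k) :
    η + β - G ≤ -(g - e - b) * k := by
  nlinarith

/-- **THE BRACKETS' CONSTANT IS A PER-CUBE CURRENCY**: with the exponent extensive as above and the fibre-volume ratio extensive too,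
`vS∕vW ≤ e^{v·k}` (`v ≍ dim F_□·log(1∕r)` per cube — the sup-form's price, lens KT-66 (i); print's Laplace refinement replaces it by (1.11)'s
`O(1) log M` per cube), 38g's constant obeys `e^{η+β−G}·(vS∕vW) ≤ q_□^k` with the ONE-CUBE currency `q_□ := e^{−(g−e−b−v)}` — a currency
(`< 1`) iff `g > e + b + v` per cube. [textbook] -/
theorem bracketsConst_le_perCube {G η β g e b v : ℝ} {k : ℕ} {vS vW : ℝ≥0∞}
    (hG : g * k ≤ G) (hη : η ≤ e * k) (hβ : β ≤ b * k) (hvol : vS / vW ≤ ENNReal.ofReal (Real.exp (v * k))) :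
    ENNReal.ofReal (Real.exp (η + β - G)) * (vS / vW) ≤ ENNReal.ofReal (Real.exp (-(g - e - b - v)) ^ k) := by
  calc ENNReal.ofReal (Real.exp (η + β - G)) * (vS / vW)
      ≤ ENNReal.ofReal (Real.exp (η + β - G)) * ENNReal.ofReal (Real.exp (v * k)) := by gcongr
    _ = ENNReal.ofReal (Real.exp (η + β - G + v * k)) := by
        rw [← ENNReal.ofReal_mul (Real.exp_pos _).le, ← Real.exp_add]
    _ ≤ ENNReal.ofReal (Real.exp ((k : ℝ) * -(g - e - b - v))) :=
        ENNReal.ofReal_le_ofReal (Real.exp_le_exp.2 (by nlinarith [brackets_exponent_le hG hη hβ]))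
    _ = ENNReal.ofReal (Real.exp (-(g - e - b - v)) ^ k) := by rw [Real.exp_nat_mul]

variable {ι : Type*} [DecidableEq ι] {X : ι → Type*} [∀ i, MeasurableSpace (X i)] (μ : ∀ i, Measure (X i))

variable {μ} in
/-- **38c's `hquotA` WITH A PER-CUBE CURRENCY** — 38g `hquot_of_actionBrackets_cmp` (two sup-inequalities on the effective action, two backgrounds,
two fibre-volume bounds) followed by `bracketsConst_le_perCube`: on the (1.88)-refined pair of a sent component of `k` cubes,
`∫⋯∫⁻_s (φ·a) ≤ q_□^k · ∫⋯∫⁻_s (φ·ins)` for EVERY exterior, `q_□ = e^{−(g−e−b−v)}` — the shape 38f's `charge_le_of_liveWindow` and §1's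
`charge_le_of_liveWindow_collar` consume (`qc ≤ q_□^{#part}·(1+Q₀)^{m}`).  All of `g, e, b, v` DISPLAYED (NODE O). [folklore] -/
theorem hquot_perCube_of_actionBrackets (s : Finset ι) {S W : Set (∀ i, X i)} (hS : MeasurableSet S)
    (hW : MeasurableSet W) {φ a ins : (∀ i, X i) → ℝ≥0∞} {f fI E₀ E₁ : (∀ i, X i) → ℝ} {G η β g e b v : ℝ} {k : ℕ}
    {vS vW : ℝ≥0∞} (hφ : IndepOf s φ) (hE₀ : ∀ (x : ∀ i, X i) (y : ∀ i : s, X i), E₀ (updateFinset x s y) = E₀ x)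
    (hE₁ : ∀ (x : ∀ i, X i) (y : ∀ i : s, X i), E₁ (updateFinset x s y) = E₁ x) (ha : Measurable a)
    (hinsm : Measurable ins) (haS : ∀ V, a V ≤ ENNReal.ofReal (Real.exp (-f V)) * S.indicator 1 V)
    (hgap : ∀ V ∈ S, E₁ V + G ≤ f V) (hvS : ∀ V, (∫⋯∫⁻_s, S.indicator 1 ∂μ) V ≤ vS)
    (hinsW : ∀ V, φ V ≠ 0 → ENNReal.ofReal (Real.exp (-fI V)) * W.indicator 1 V ≤ ins V)
    (hall : ∀ V ∈ W, fI V ≤ E₀ V + η) (hcmp : ∀ V, φ V ≠ 0 → E₀ V ≤ E₁ V + β)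
    (hvW : ∀ V, φ V ≠ 0 → vW ≤ (∫⋯∫⁻_s, W.indicator 1 ∂μ) V) (hvW0 : vW ≠ 0) (hvWtop : vW ≠ ⊤)
    (hG : g * k ≤ G) (hη : η ≤ e * k) (hβ : β ≤ b * k) (hvol : vS / vW ≤ ENNReal.ofReal (Real.exp (v * k))) :
    ∀ V, (∫⋯∫⁻_s, φ * a ∂μ) V
      ≤ ENNReal.ofReal (Real.exp (-(g - e - b - v)) ^ k) * (∫⋯∫⁻_s, φ * ins ∂μ) V := fun V =>
  (hquot_of_actionBrackets_cmp s hS hW hφ hE₀ hE₁ ha hinsm haS hgap hvS hinsW hall hcmp hvW hvW0 hvWtop V).trans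
    (by gcongr; exact bracketsConst_le_perCube hG hη hβ hvol)

end PerCube

end Summit.QuantumFields.YangMills.Theorems.N21CollarChargeByCounting
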